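import Mathlib
import Literature.AlgebraicGeometry.Resolution.CobordantGame
import Literature.AlgebraicGeometry.Resolution.CobordantChartCoefficients
import Literature.AlgebraicGeometry.Resolution.CobordantTupleGame
import Literature.AlgebraicGeometry.Resolution.FormalCoordinateChange
import Summits.ResolutionOfSingularities.ResolutionOfSingularities.Theorems.WeightedInvariantLocalWeightedDropWildPurePowerGeneric
import Summits.ResolutionOfSingularities.ResolutionOfSingularities.Theorems.WeightedInvariantLocalWeightedDropWildPurePowerCleanSteps
import Summits.ResolutionOfSingularities.ResolutionOfSingularities.Theorems.WeightedInvariantLocalWeightedDropWildTerminalStep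

/-!
# `WeightedInvariant.LocalWeightedDrop`, line `hasse-ridge-face-selection`: COEFFICIENT TRANSPORT of a monic tuple under the
# two terminal moves (curve blow-up `V(x_i, y)`, point blow-up at an axis point) and the order drop off the axes — tools for the
# monomial terminal class of S3ρT

Crux item stmt-ResolutionOfSingularities-8899 `LocalWeightedDrop` (route `ResolutionOfSingularities/WeightedInvariant`), engine of
the door `HypersurfaceCentreConstruction` stmt-ResolutionOfSingularities-19897.  [OURS · L1 W4.3, chain w43, res-type-083 (extra
seat S3ρ, CHAIN v4.3 D12): §1 (T) of `L/res-type-083/S3RHO-DESIGN.md`.  Not a statement of any manuscript.]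

For a coefficient `A_j` of a monic form `y^d + Σ A_j y^j` and `q = d - j`:
* `coeff_curveSucc_zero/one`: after the blow-up of `V(x_i, y)` (brick `won_monic_of_curveBlowup`, `A_j = x_i^q A''_j`) the
  successor coefficient `c^q · (A''_j ∘ chart_i)|` has `[x^β] = c^{q + β₀} · [x^{β + q e₀}] A_j` (`i = 0`) resp. the same with the
  two letters swapped (`i = 1`) — the scaled support translates by `-q e_i` (`WildTerminal.coeff_slice_subst_axisChart_*`);
* `coeff_pointSucc_axis₀/₁`: after the point blow-up at an AXIS point `(c₀, 0)` (slot `0`) resp. `(0, c₁)` (slot `1`) the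
  successor coefficient `(s B_j)|` (`A_j ∘ chart(c) = s^{q+1} B_j`) has `[s^{β₀} x^{β₁}] = c^{…} · [x₀^{β₀+q-β₁} x₁^{β₁}] A_j`
  — the support map `α ↦ (|α| - q, α₁)` (resp. with the letters swapped) (`WildPurePower.coeff_slice_subst_pointChart_axis*`);
* `order_pointSucc_le_of_monomialUnit`: at an exceptional point with BOTH coordinates non-zero, a coefficient `x^α · U`
  (`U(0) ≠ 0`, `|α| > q`) has successor of order `≤ |α| - q` (`WildTerminal.X_mul_pointBv`: it is `s^{|α|-q}` times a unit).
-/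

set_option linter.dupNamespace false -- mandated namespace of this single-conjunct summit

namespace Summit.ResolutionOfSingularities.ResolutionOfSingularities.Theorems

open Literature.AlgebraicGeometry.Resolution
open Literature.AlgebraicGeometry.Resolution.CobordantGame

namespace WildMonic

open MvPowerSeries WildTerminal

variable {k : Type} [Field k]

/-! ### Dividing a power of a variable -/

/-- `[x^β] A'' = [x^{β + n e_i}] (x_i^n · A'')`. -/
theorem coeff_add_single_X_pow_mul' (i : Fin 2) (n : ℕ) (T : MvPowerSeries (Fin 2) k) (β : Fin 2 →₀ ℕ) :
    coeff (β + Finsupp.single i n) ((X i : MvPowerSeries (Fin 2) k) ^ n * T) = coeff β T := by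
  classical
  rw [X_pow_eq, coeff_monomial_mul, if_pos (by intro l; rw [Finsupp.add_apply]; exact le_add_self), one_mul,
    add_tsub_cancel_right]

/-- A series all of whose monomials have `x_i`-exponent `≥ n` is `x_i^n` times a series. -/
theorem exists_eq_X_pow_mul_of_coeff (i : Fin 2) (n : ℕ) (T : MvPowerSeries (Fin 2) k)
    (h : ∀ β : Fin 2 →₀ ℕ, coeff β T ≠ 0 → n ≤ β i) :
    ∃ T' : MvPowerSeries (Fin 2) k, T = X i ^ n * T' := by
  have hdvd : (X i : MvPowerSeries (Fin 2) k) ^ n ∣ T :=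
    X_pow_dvd_iff.mpr fun β hβ => by
      by_contra hne
      exact absurd (h β hne) (not_le.mpr hβ)
  obtain ⟨T', hT'⟩ := hdvd
  exact ⟨T', hT'⟩

/-- A `Fin 2`-exponent is the sum of its two single parts. -/
theorem finsupp_two_eq (β : Fin 2 →₀ ℕ) : β = Finsupp.single 0 (β 0) + Finsupp.single 1 (β 1) := by
  ext l; fin_cases l <;> simp

/-! ### The curve step -/

/-- CURVE STEP `V(x₁, y)` (slot `0`), COEFFICIENT BY COEFFICIENT: for `A = x₀^q · A''`,
`[x^β] (c^q · (A'' ∘ chart₀)|) = c^{q + β₀} · [x^{β + q e₀}] A`. -/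
theorem coeff_curveSucc_zero (c : k) (q : ℕ) (A A'' : MvPowerSeries (Fin 2) k) (hA : A = X 0 ^ q * A'')
    (β : Fin 2 →₀ ℕ) :
    coeff β (C (c ^ q) * TupleGame.slice (0 : Fin 2) (subst (CobordantChart.chart (fun l : Fin 2 => if l = 0 then 1 else 0)
        (fun l : Fin 2 => if l = 0 then c else 0)) A'')) =
      c ^ (q + β 0) * coeff (β + Finsupp.single 0 q) A := by
  rw [coeff_C_mul, coeff_slice_subst_axisChart_zero, ← finsupp_two_eq, hA, coeff_add_single_X_pow_mul', pow_add, mul_assoc]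

/-- CURVE STEP `V(x₂, y)` (slot `1`; the letters swap), COEFFICIENT BY COEFFICIENT: for `A = x₁^q · A''`,
`[x₀^{β₀} x₁^{β₁}] (c^q · (A'' ∘ chart₁)|) = c^{q + β₀} · [x₀^{β₁} x₁^{β₀ + q}] A`. -/
theorem coeff_curveSucc_one (c : k) (q : ℕ) (A A'' : MvPowerSeries (Fin 2) k) (hA : A = X 1 ^ q * A'')
    (β : Fin 2 →₀ ℕ) :
    coeff β (C (c ^ q) * TupleGame.slice (1 : Fin 2) (subst (CobordantChart.chart (fun l : Fin 2 => if l = 1 then 1 else 0)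
        (fun l : Fin 2 => if l = 1 then c else 0)) A'')) =
      c ^ (q + β 0) * coeff (Finsupp.single 0 (β 1) + Finsupp.single 1 (β 0 + q)) A := by
  rw [coeff_C_mul, coeff_slice_subst_axisChart_one, hA, pow_add, mul_assoc]
  congr 2
  have h : (Finsupp.single 0 (β 1) + Finsupp.single 1 (β 0 + q) : Fin 2 →₀ ℕ) =
      (Finsupp.single 1 (β 0) + Finsupp.single 0 (β 1)) + Finsupp.single 1 q := by
    ext l; fin_cases l <;> simp
  rw [h, coeff_add_single_X_pow_mul']

/-! ### The point step at an axis point -/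

/-- POINT STEP AT THE AXIS POINT `(c₀, 0)`, SLOT `0`, COEFFICIENT BY COEFFICIENT: with `A ∘ chart(c) = s^{q+1} B`,
`[s^{β₀} x^{β₁}] (s B)| = c₀^{β₀+q-β₁} · [x₀^{β₀+q-β₁} x₁^{β₁}] A` if `β₁ ≤ β₀ + q`, else `0`. -/
theorem coeff_pointSucc_axis₀ {q : ℕ} (c : Fin 2 → k) (hc : c 1 = 0) (A : MvPowerSeries (Fin 2) k)
    (B : MvPowerSeries (Fin (2 + 1)) k) (hB : subst (CobordantChart.chart (fun _ : Fin 2 => 1) c) A = X 0 ^ (q + 1) * B)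
    (β : Fin 2 →₀ ℕ) :
    coeff β (TupleGame.slice (0 : Fin 2) (X 0 * B)) =
      if β 1 ≤ β 0 + q then c 0 ^ (β 0 + q - β 1) * coeff (Finsupp.single 0 (β 0 + q - β 1) + Finsupp.single 1 (β 1)) A
      else 0 := by
  classical
  rw [← WildPurePower.coeff_add_single_X_pow_mul q _ β, ← WildPurePower.slice_subst_pointChart_eq_X_pow_mul 0 c A B hB,
    WildPurePower.coeff_slice_subst_pointChart_axis₀ c hc A]
  simp only [Finsupp.add_apply, Finsupp.single_eq_same, Finsupp.single_eq_of_ne (show (1 : Fin 2) ≠ 0 by decide), add_zero]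

/-- POINT STEP AT THE AXIS POINT `(0, c₁)`, SLOT `1`, COEFFICIENT BY COEFFICIENT (letters swapped):
`[s^{β₀} x^{β₁}] (s B)| = c₁^{β₀+q-β₁} · [x₀^{β₁} x₁^{β₀+q-β₁}] A` if `β₁ ≤ β₀ + q`, else `0`. -/
theorem coeff_pointSucc_axis₁ {q : ℕ} (c : Fin 2 → k) (hc : c 0 = 0) (A : MvPowerSeries (Fin 2) k)
    (B : MvPowerSeries (Fin (2 + 1)) k) (hB : subst (CobordantChart.chart (fun _ : Fin 2 => 1) c) A = X 0 ^ (q + 1) * B)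
    (β : Fin 2 →₀ ℕ) :
    coeff β (TupleGame.slice (1 : Fin 2) (X 0 * B)) =
      if β 1 ≤ β 0 + q then c 1 ^ (β 0 + q - β 1) * coeff (Finsupp.single 0 (β 1) + Finsupp.single 1 (β 0 + q - β 1)) A
      else 0 := by
  classical
  rw [← WildPurePower.coeff_add_single_X_pow_mul q _ β, ← WildPurePower.slice_subst_pointChart_eq_X_pow_mul 1 c A B hB,
    WildPurePower.coeff_slice_subst_pointChart_axis₁ c hc A]
  simp only [Finsupp.add_apply, Finsupp.single_eq_same, Finsupp.single_eq_of_ne (show (1 : Fin 2) ≠ 0 by decide), add_zero]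

/-! ### The point step off the axes: a monomial unit coefficient drops the order -/

/-- POINT STEP AT A POINT WITH BOTH COORDINATES NON-ZERO: a coefficient `x₀^r x₁^t · U` (`U(0) ≠ 0`, `r + t > q`) has
successor `(s B)|` of order `≤ r + t - q` in either live slot (it is `s^{r+t-q}` times a unit). -/
theorem order_pointSucc_le_of_monomialUnit {q r t : ℕ} (hq : 0 < q) (hrt : q < r + t) (c : Fin 2 → k) (hc0 : c 0 ≠ 0)
    (hc1 : c 1 ≠ 0) (U : MvPowerSeries (Fin 2) k) (hU : constantCoeff U ≠ 0) (B : MvPowerSeries (Fin (2 + 1)) k)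
    (hB : subst (CobordantChart.chart (fun _ : Fin 2 => 1) c) ((X 0 : MvPowerSeries (Fin 2) k) ^ r * X 1 ^ t * U) =
      X 0 ^ (q + 1) * B) (i₀ : Fin 2) :
    (TupleGame.slice i₀ (X 0 * B)).order ≤ ((r + t - q : ℕ) : ℕ∞) := by
  classical
  -- `s · B = s^{r+t-q} · (c₀+y₁)^r (c₁+y₂)^t · U∘chart`
  have hXB := X_mul_pointBv (d := q) hq hrt c U B (by rw [Fin.val_mk, Nat.sub_zero]; exact hB)
  have hunit : ∀ G : MvPowerSeries (Fin 2) k, constantCoeff G ≠ 0 →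
      ((X 0 : MvPowerSeries (Fin 2) k) ^ (r + t - q) * G).order ≤ ((r + t - q : ℕ) : ℕ∞) := by
    intro G hG
    refine le_trans (order_le (d := Finsupp.single 0 (r + t - q)) ?_) (by rw [Finsupp.degree_single])
    rw [X_pow_eq, coeff_monomial_mul, if_pos le_rfl, tsub_self, one_mul, coeff_zero_eq_constantCoeff]
    exact hG
  have hi : i₀ = 0 ∨ i₀ = 1 := by fin_cases i₀ <;> simp
  rcases hi with rfl | rfl
  · rw [hXB, slice_mul, slice_pow, slice_X_zero, slice_zero_pointFactor, ← mul_assoc, ← mul_assoc]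
    rw [mul_assoc (X 0 ^ (r + t - q)), mul_assoc (X 0 ^ (r + t - q))]
    refine hunit _ ?_
    rw [map_mul, map_mul, map_pow, map_pow, constantCoeff_C, map_add, constantCoeff_C, constantCoeff_X, add_zero,
      constantCoeff_slice_subst_pointChart]
    exact mul_ne_zero (mul_ne_zero (pow_ne_zero _ hc0) (pow_ne_zero _ hc1)) hU
  · rw [hXB, slice_mul, slice_pow, slice_X_zero, slice_one_pointFactor, ← mul_assoc, ← mul_assoc]
    rw [mul_assoc (X 0 ^ (r + t - q)), mul_assoc (X 0 ^ (r + t - q))]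
    refine hunit _ ?_
    rw [map_mul, map_mul, map_pow, map_pow, map_add, constantCoeff_C, constantCoeff_X, add_zero, constantCoeff_C,
      constantCoeff_slice_subst_pointChart]
    exact mul_ne_zero (mul_ne_zero (pow_ne_zero _ hc0) (pow_ne_zero _ hc1)) hU

end WildMonic

end Summit.ResolutionOfSingularities.ResolutionOfSingularities.Theorems
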